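import Literature.Analysis.FluidPDE.Wei2016AprioriA
import Literature.Analysis.FluidPDE.EnergyToolkit
import Literature.Analysis.FluidPDE.HouLiVariablesMemLp
import Literature.Analysis.FluidPDE.HouLiSpaceTime
import Literature.Analysis.FluidPDE.KNSSThm52Integrand
import HarnessLib

/-!
# The dissipation integral `∫₀ᵀ ‖∇Ω‖²` and the bound `∫₀ᵀ ‖vʳ/r‖_∞ ≤ Λ` (Wei 2016, end of proof)

Analysis/FluidPDE proof file (theorems only; no definitions, no named facts) on the way to
`Literature.Analysis.FluidPDE.Wei2016_logModulus_regularity`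
(`LeiZhang2017AxisymmetricCriteria.lean`). Wei (arXiv:1508.03318, §3, after (3.7)) concludes
"`A(T*) ≤ C`, then as in [8], this implies that `v ∈ L^∞(0,T*; L⁴(ℝ³))` and `v` is regular".
Lei–Zhang's argument ([8], §3 p. 9) controls `‖vʳ/r‖_{L¹_t L^∞_x}` through
`‖vʳ/r‖_∞ ≤ C_A (‖Ω‖₂ ‖∂_zΩ‖₂)^{1/2}` (`IsAxisymmetric.abs_radVelQuot_le_of_sobolev`) and the
time-integrated dissipation `∫₀ᵀ ‖∇Ω‖²₂`, which the differential inequality (3.7)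
(`Wei2016.slice_ode_bound`, with the leftover factor `1 − θ`) bounds once `A ≤ Y`:

* `Wei2016.continuousOn_integral_sq_fderiv_slice` — continuity in time of
  `∫ (∂ᵥQ(t))²` for a jointly smooth family with uniform `H¹` bounds of `Q` and `∂ₜQ`
  (`Wei2016.weighted_sq_balance`);
* `IsTaoSolutionOn.continuousOn_dissipation_angVortQuot` — continuity of
  `t ↦ ∫ |∇Ω(t)|²` and of `t ↦ ∫ (∂_zΩ(t))²` in Tao's class;
* `IsTaoSolutionOn.intervalIntegral_dissipation_le` —
  `(1−θ)p² ∫₀ᵗ ∫|∇Ω|² ≤ A(0) + C_g M₂ E(u₀) max{Y^{4/3}/κ, r₀⁻⁴}` under the hypotheses of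
  `IsTaoSolutionOn.F_energyA_le` and `A ≤ Y` on `[0, T]`;
* `IsTaoSolutionOn.exists_radVelQuot_bound` — a continuous `a ≥ 0` on `[0, T]` with
  `|vʳ(t)/r| ≤ a(t)` and `∫₀ᵗ a ≤ C_A M_Ω^{1/4} (3T/4 + D/4)` whenever `∫Ω(t)² ≤ M_Ω` and
  `∫₀ᵗ∫(∂_zΩ)² ≤ D` (`x^{1/4} ≤ 3/4 + x/4`).

## References

* D. Wei, arXiv:1508.03318, §3 (end of the proof of Thm. 1.1). [Wei2016]
* Z. Lei, Q. S. Zhang, arXiv:1505.02628, §3 p. 9 and §4 p. 10. [LeiZhang2017]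
-/

noncomputable section

open MeasureTheory Set Function Filter Topology InnerProductSpace
open scoped RealInnerProductSpace ContDiff ENNReal NNReal

namespace Literature.Analysis.FluidPDE

namespace Wei2016

/-- `‖Df(x) v‖ₑ² ≤ ‖D¹f(x)‖ₑ²` for `‖v‖ ≤ 1`. [folklore] -/
theorem enorm_sq_fderiv_apply_le {f : EuclideanSpace ℝ (Fin 3) → ℝ} {v : EuclideanSpace ℝ (Fin 3)}
    (hv : ‖v‖ ≤ 1) (x : EuclideanSpace ℝ (Fin 3)) :
    ‖fderiv ℝ f x v‖ₑ ^ 2 ≤ ‖iteratedFDeriv ℝ 1 f x‖ₑ ^ 2 := by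
  have h : ‖fderiv ℝ f x v‖ ≤ ‖iteratedFDeriv ℝ 1 f x‖ := by
    rw [norm_iteratedFDeriv_one]
    calc ‖fderiv ℝ f x v‖ ≤ ‖fderiv ℝ f x‖ * ‖v‖ := (fderiv ℝ f x).le_opNorm v
      _ ≤ ‖fderiv ℝ f x‖ * 1 := mul_le_mul_of_nonneg_left hv (norm_nonneg _)
      _ = ‖fderiv ℝ f x‖ := mul_one _
  rw [← ofReal_norm, ← ofReal_norm, ← ENNReal.ofReal_pow (norm_nonneg _), ← ENNReal.ofReal_pow (norm_nonneg _)]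
  exact ENNReal.ofReal_le_ofReal (pow_le_pow_left₀ (norm_nonneg _) h 2)

/-- **Continuity in time of `∫ (∂ᵥQ(t))²`** for a jointly smooth scalar family `Q` on `[0, T]`
with uniform bounds `∫ |D¹Q(t)|², ∫ |D¹∂ₜQ(t)|² ≤ C` and `‖v‖ ≤ 1`; each slice integrand is
integrable. [folklore] -/
theorem continuousOn_integral_sq_fderiv_slice {T : ℝ} (hT : 0 < T)
    {Q : ℝ → EuclideanSpace ℝ (Fin 3) → ℝ} (hQ : FluidPDE.IsSmoothSpaceTimeOn (Icc 0 T) Q) {C : ℝ≥0}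
    (h1 : ∀ t ∈ Icc 0 T, ∫⁻ x, ‖iteratedFDeriv ℝ 1 (Q t) x‖ₑ ^ 2 ≤ C)
    (h1t : ∀ t ∈ Icc 0 T, ∫⁻ x, ‖iteratedFDeriv ℝ 1 (FluidPDE.timeDerivWithin (Icc 0 T) Q t) x‖ₑ ^ 2 ≤ C)
    {v : EuclideanSpace ℝ (Fin 3)} (hv : ‖v‖ ≤ 1) :
    ContinuousOn (fun t => ∫ x, fderiv ℝ (Q t) x v ^ 2) (Icc 0 T) ∧
    ∀ t ∈ Icc 0 T, Integrable (fun x => fderiv ℝ (Q t) x v ^ 2) volume := by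
  have hU : UniqueDiffOn ℝ (Icc 0 T) := uniqueDiffOn_Icc hT
  have hIcl : Icc 0 T ⊆ closure (interior (Icc 0 T)) := Icc_subset_closure_interior_Icc' hT
  have hg : FluidPDE.IsSmoothSpaceTimeOn (Icc 0 T) fun t x => fderiv ℝ (Q t) x v := hQ.fderiv_slice_apply hU v
  have hg' : ∀ t ∈ Icc 0 T, ∀ x, FluidPDE.timeDerivWithin (Icc 0 T) (fun s y => fderiv ℝ (Q s) y v) t x =
      fderiv ℝ (FluidPDE.timeDerivWithin (Icc 0 T) Q t) x v := fun t ht x =>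
    hQ.timeDerivWithin_fderiv_slice_apply hU hIcl ht x v
  have hC₀ : ∀ t ∈ Icc 0 T, ∫⁻ x, ‖(1 : ℝ) * fderiv ℝ (Q t) x v‖ₑ ^ 2 ≤ (C : ℝ≥0∞) := fun t ht => by
    simp only [one_mul]
    exact (lintegral_mono fun x => enorm_sq_fderiv_apply_le hv x).trans (h1 t ht)
  have hC₁ : ∀ t ∈ Icc 0 T, ∫⁻ x, ‖(1 : ℝ) * FluidPDE.timeDerivWithin (Icc 0 T) (fun s y => fderiv ℝ (Q s) y v) t x‖ₑ ^ 2 ≤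
      (C : ℝ≥0∞) := fun t ht => by
    simp only [one_mul]
    calc ∫⁻ x, ‖FluidPDE.timeDerivWithin (Icc 0 T) (fun s y => fderiv ℝ (Q s) y v) t x‖ₑ ^ 2
        = ∫⁻ x, ‖fderiv ℝ (FluidPDE.timeDerivWithin (Icc 0 T) Q t) x v‖ₑ ^ 2 :=
          lintegral_congr fun x => by rw [hg' t ht x]
      _ ≤ ∫⁻ x, ‖iteratedFDeriv ℝ 1 (FluidPDE.timeDerivWithin (Icc 0 T) Q t) x‖ₑ ^ 2 :=
          lintegral_mono fun x => enorm_sq_fderiv_apply_le hv x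
      _ ≤ C := h1t t ht
  obtain ⟨_, hC, _⟩ := weighted_sq_balance hT hg measurable_const hC₀ hC₁
  refine ⟨hC.congr fun t _ => by simp only [one_mul], fun t ht => ?_⟩
  have hm : MemLp (fun x => fderiv ℝ (Q t) x v) 2 volume :=
    memLp_two_of_lintegral_sq_le_coe ((hg.contDiff_slice ht).continuous) (by simpa only [one_mul] using hC₀ t ht)
  exact hm.integrable_sq

end Wei2016

variable {T : ℝ} {u₀ : EuclideanSpace ℝ (Fin 3) → EuclideanSpace ℝ (Fin 3)}
  {v : ℝ → EuclideanSpace ℝ (Fin 3) → EuclideanSpace ℝ (Fin 3)} {q : ℝ → EuclideanSpace ℝ (Fin 3) → ℝ}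

set_option maxHeartbeats 800000 in
/-- **Continuity of the `Ω`-dissipation in Tao's class**: for a Tao-class solution with
axisymmetric slices, `t ↦ ∫ (∂ᵥΩ(t))²` is continuous on `[0, T]` for every `‖v‖ ≤ 1`, and the
slice integrands are integrable (`Ω = angVortQuot`; `∂ₜΩ = angVortQuot (∂ₜu)`). [folklore] -/
theorem IsTaoSolutionOn.continuousOn_dissipation_angVortQuot (h : IsTaoSolutionOn T 1 u₀ v q) (hT : 0 < T)
    (hax : ∀ t ∈ Icc 0 T, IsAxisymmetric (v t)) {w : EuclideanSpace ℝ (Fin 3)} (hw : ‖w‖ ≤ 1) :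
    ContinuousOn (fun t => ∫ x, fderiv ℝ (angVortQuot (v t)) x w ^ 2) (Icc 0 T) ∧
    ∀ t ∈ Icc 0 T, Integrable (fun x => fderiv ℝ (angVortQuot (v t)) x w ^ 2) volume := by
  have hU : UniqueDiffOn ℝ (Icc 0 T) := uniqueDiffOn_Icc hT
  have hcv : Convex ℝ (Icc (0 : ℝ) T) := convex_Icc 0 T
  have hIcl : Icc 0 T ⊆ closure (interior (Icc 0 T)) := Icc_subset_closure_interior_Icc' hT
  have hsm : IsSmoothSpaceTimeOn (Icc 0 T) v := h.classical.smooth_velocity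
  have hQ : IsSmoothSpaceTimeOn (Icc 0 T) fun t => angVortQuot (v t) := hsm.angVortQuot_family hcv hU
  have hQ' : ∀ t ∈ Icc 0 T, FluidPDE.timeDerivWithin (Icc 0 T) (fun s => angVortQuot (v s)) t =
      angVortQuot (FluidPDE.timeDerivWithin (Icc 0 T) v t) := fun t ht =>
    funext fun x => hsm.timeDerivWithin_angVortQuot hcv hU hIcl hax ht x
  have hvs : ∀ t ∈ Icc 0 T, ContDiff ℝ ∞ (v t) := fun t ht => h.classical.contDiff_velocity ht
  have hws : ∀ t ∈ Icc 0 T, ContDiff ℝ ∞ (FluidPDE.timeDerivWithin (Icc 0 T) v t) := fun t ht =>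
    hsm.contDiff_timeDerivWithin_slice hU ht
  have hwax : ∀ t ∈ Icc 0 T, IsAxisymmetric (FluidPDE.timeDerivWithin (Icc 0 T) v t) := fun t ht =>
    hsm.isAxisymmetric_timeDerivWithin hax ht
  obtain ⟨C3, hC3⟩ := h.sobolev 3
  obtain ⟨D3, hD3⟩ := h.sobolev_dt 3
  set c : ℝ := ‖(curlCLM : (EuclideanSpace ℝ (Fin 3) →L[ℝ] EuclideanSpace ℝ (Fin 3)) →L[ℝ]
      EuclideanSpace ℝ (Fin 3))‖ with hc_def
  have h1 : ∀ t ∈ Icc 0 T, ∫⁻ x, ‖iteratedFDeriv ℝ 1 (angVortQuot (v t)) x‖ₑ ^ 2 ≤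
      ((Real.toNNReal (c ^ 4) * (C3 + D3) : ℝ≥0) : ℝ≥0∞) := by
    intro t ht
    have := (hax t ht).lintegral_sq_iteratedFDeriv_angVortQuot_le (hvs t ht) 1
    refine this.trans ?_
    rw [ENNReal.coe_mul]
    exact mul_le_mul' (le_of_eq rfl) ((hC3 t ht).trans (ENNReal.coe_le_coe.2 le_self_add))
  have h1t : ∀ t ∈ Icc 0 T, ∫⁻ x, ‖iteratedFDeriv ℝ 1 (FluidPDE.timeDerivWithin (Icc 0 T) (fun s => angVortQuot (v s)) t) x‖ₑ ^ 2 ≤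
      ((Real.toNNReal (c ^ 4) * (C3 + D3) : ℝ≥0) : ℝ≥0∞) := by
    intro t ht
    rw [hQ' t ht]
    have := (hwax t ht).lintegral_sq_iteratedFDeriv_angVortQuot_le (hws t ht) 1
    refine this.trans ?_
    rw [ENNReal.coe_mul]
    exact mul_le_mul' (le_of_eq rfl) ((hD3 t ht).trans (ENNReal.coe_le_coe.2 le_add_self))
  exact Wei2016.continuousOn_integral_sq_fderiv_slice hT hQ h1 h1t hw

set_option maxHeartbeats 1600000 in
/-- **The time-integrated `Ω`-dissipation is bounded** (Wei 2016, §3, from (3.7) with the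
leftover dissipation factor `1 − θ`): under the hypotheses of `IsTaoSolutionOn.F_energyA_le`
with `θ < 1`, if `A(t) = ∫J(t)² + ½p²∫Ω(t)² ≤ Y` on `[0, T]`, then for every `t ∈ [0, T]`
`(1 − θ) p² ∫₀ᵗ ∫ |∇Ω|² ≤ A(0) + C_g M₂ E(u₀) max{Y^{4/3}/κ, r₀⁻⁴}`
(`κ = (εK)^{8/3}`, `M₂ = θ + pΓ_b + Γ_b²/p²`, `C_g` the constant of `Wei2016.slice_ode_bound`).
[cite: Wei2016, §3 (3.7) and the end of the proof of Thm. 1.1] -/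
theorem IsTaoSolutionOn.intervalIntegral_dissipation_le (h : IsTaoSolutionOn T 1 u₀ v q) (hT : 0 < T)
    (hax : ∀ t ∈ Icc 0 T, IsAxisymmetric (v t))
    {ε p θ K r₀ Γb : ℝ} (hε : 0 < ε) (hε1 : ε ≤ 1) (hp : 0 < p) (hp3 : p ^ 3 = ε) (hθ0 : 0 ≤ θ)
    (hθ1 : θ < 1) (hK : 1 ≤ K) (hr₀ : 0 < r₀) (hΓb0 : 0 ≤ Γb)
    (hM : ε * (1 + Real.log K + Real.log K ^ 2 / 2) = θ / p)
    (hΓε : ∀ t ∈ Icc 0 T, ∀ x, 0 < cylRadius x → cylRadius x ≤ r₀ → |swirl (v t) x| ≤ ε)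
    (hΓb : ∀ t ∈ Icc 0 T, ∀ x, |swirl (v t) x| ≤ Γb)
    {Y : ℝ}
    (hY : ∀ t ∈ Icc 0 T, (∫ x, radVelQuot (curl (v t)) x ^ 2) + p ^ 2 / 2 * ∫ x, angVortQuot (v t) x ^ 2 ≤ Y) :
    ∀ t ∈ Icc 0 T, (1 - θ) * p ^ 2 * ∫ s in (0 : ℝ)..t, ∫ x,
        (fderiv ℝ (angVortQuot (v s)) x (EuclideanSpace.single 0 1) ^ 2 +
          fderiv ℝ (angVortQuot (v s)) x (EuclideanSpace.single 1 1) ^ 2 +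
          fderiv ℝ (angVortQuot (v s)) x (EuclideanSpace.single 2 1) ^ 2) ≤
      ((∫ x, radVelQuot (curl (v 0)) x ^ 2) + p ^ 2 / 2 * ∫ x, angVortQuot (v 0) x ^ 2) +
        Wei2016.hardyConst * ((4 : ℝ) ^ (2 / 3 : ℝ) *
          (192 + 8 * ‖(curlCLM : (EuclideanSpace ℝ (Fin 3) →L[ℝ] EuclideanSpace ℝ (Fin 3)) →L[ℝ]
            EuclideanSpace ℝ (Fin 3))‖ ^ 2) ^ (1 / 3 : ℝ) * ((radialConst₂ ^ 2)⁻¹) ^ (2 / 3 : ℝ) +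
          (192 + 8 * ‖(curlCLM : (EuclideanSpace ℝ (Fin 3) →L[ℝ] EuclideanSpace ℝ (Fin 3)) →L[ℝ]
            EuclideanSpace ℝ (Fin 3))‖ ^ 2)) *
        (θ + p * Γb + Γb ^ 2 / p ^ 2) * VectorCalculus.kineticEnergy u₀ *
          max (Y ^ (4 / 3 : ℝ) / (ε * K) ^ (8 / 3 : ℝ)) (r₀ ^ 4)⁻¹ := by
  -- opaque constants
  obtain ⟨Cg, hCg⟩ : ∃ Cg : ℝ, Cg = Wei2016.hardyConst * ((4 : ℝ) ^ (2 / 3 : ℝ) *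
          (192 + 8 * ‖(curlCLM : (EuclideanSpace ℝ (Fin 3) →L[ℝ] EuclideanSpace ℝ (Fin 3)) →L[ℝ]
            EuclideanSpace ℝ (Fin 3))‖ ^ 2) ^ (1 / 3 : ℝ) * ((radialConst₂ ^ 2)⁻¹) ^ (2 / 3 : ℝ) +
          (192 + 8 * ‖(curlCLM : (EuclideanSpace ℝ (Fin 3) →L[ℝ] EuclideanSpace ℝ (Fin 3)) →L[ℝ]
            EuclideanSpace ℝ (Fin 3))‖ ^ 2)) := ⟨_, rfl⟩
  set M₂ : ℝ := θ + p * Γb + Γb ^ 2 / p ^ 2 with hM₂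
  set κ : ℝ := (ε * K) ^ (8 / 3 : ℝ) with hκ
  set ρ : ℝ := (r₀ ^ 4)⁻¹ with hρ
  rw [← hCg]
  -- the energy `A`, its density, the enstrophy, the dissipation
  obtain ⟨A, hA⟩ : ∃ A : ℝ → ℝ, A = fun t => (∫ x, radVelQuot (curl (v t)) x ^ 2) +
      p ^ 2 / 2 * ∫ x, angVortQuot (v t) x ^ 2 := ⟨_, rfl⟩
  obtain ⟨φ, hφ⟩ : ∃ φ : ℝ → ℝ, φ = fun t => (∫ x, 2 * radVelQuot (curl (v t)) x *
      radVelQuot (curl (timeDerivWithin (Icc 0 T) v t)) x) +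
    p ^ 2 / 2 * ∫ x, 2 * angVortQuot (v t) x * angVortQuot (timeDerivWithin (Icc 0 T) v t) x := ⟨_, rfl⟩
  obtain ⟨DΩ, hDΩf⟩ : ∃ DΩ : ℝ → ℝ, DΩ = fun s => ∫ x,
        (fderiv ℝ (angVortQuot (v s)) x (EuclideanSpace.single 0 1) ^ 2 +
          fderiv ℝ (angVortQuot (v s)) x (EuclideanSpace.single 1 1) ^ 2 +
          fderiv ℝ (angVortQuot (v s)) x (EuclideanSpace.single 2 1) ^ 2) := ⟨_, rfl⟩
  set eF : ℝ → ℝ := fun t => ∫ x, frobeniusNormSq (fderiv ℝ (v t) x) with heF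
  set g : ℝ → ℝ := fun t => Cg * M₂ * eF t with hg
  set Mx : ℝ := max (Y ^ (4 / 3 : ℝ) / κ) ρ with hMx
  have hAt : ∀ t, A t = (∫ x, radVelQuot (curl (v t)) x ^ 2) + p ^ 2 / 2 * ∫ x, angVortQuot (v t) x ^ 2 :=
    fun t => by rw [hA]
  have hDΩt : ∀ s, DΩ s = ∫ x, (fderiv ℝ (angVortQuot (v s)) x (EuclideanSpace.single 0 1) ^ 2 +
      fderiv ℝ (angVortQuot (v s)) x (EuclideanSpace.single 1 1) ^ 2 +
      fderiv ℝ (angVortQuot (v s)) x (EuclideanSpace.single 2 1) ^ 2) := fun s => by rw [hDΩf]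
  -- basic facts
  have hU : UniqueDiffOn ℝ (Icc 0 T) := uniqueDiffOn_Icc hT
  have hcl : Icc 0 T ⊆ closure (interior (Icc 0 T)) := Icc_subset_closure_interior_Icc' hT
  have hsm : IsSmoothSpaceTimeOn (Icc 0 T) v := h.classical.smooth_velocity
  have hvs : ∀ s ∈ Icc 0 T, ContDiff ℝ ∞ (v s) := fun s hs => h.classical.contDiff_velocity hs
  have hκ0 : 0 < κ := Real.rpow_pos_of_pos (mul_pos hε (by linarith)) _
  have hρ0 : 0 < ρ := inv_pos.2 (pow_pos hr₀ 4)
  have hCg0 : 0 ≤ Cg := by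
    rw [hCg]
    have h0 : 0 ≤ ‖(curlCLM : (EuclideanSpace ℝ (Fin 3) →L[ℝ] EuclideanSpace ℝ (Fin 3)) →L[ℝ]
        EuclideanSpace ℝ (Fin 3))‖ :=
      norm_nonneg (curlCLM : (EuclideanSpace ℝ (Fin 3) →L[ℝ] EuclideanSpace ℝ (Fin 3)) →L[ℝ]
        EuclideanSpace ℝ (Fin 3))
    exact mul_nonneg Wei2016.hardyConst_nonneg (by positivity)
  have hM₂0 : 0 ≤ M₂ := by rw [hM₂]; positivity
  have hMx0 : 0 ≤ Mx := le_max_of_le_right hρ0.le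
  -- continuity of `A`, integrability of `φ`, the balance
  obtain ⟨hAc, hφi, hbal⟩ := h.energyA_balance hT hax (p ^ 2 / 2)
  rw [← hA] at hAc
  have hφi' : IntegrableOn φ (Ioo 0 T) := by rw [hφ]; exact hφi
  have hbal' : ∀ s t, 0 ≤ s → s ≤ t → t ≤ T → A t - A s = ∫ τ in s..t, φ τ := by
    intro s t hs hst htT; rw [hAt, hAt, hφ]; exact hbal s t hs hst htT
  -- continuity of the enstrophy
  obtain ⟨C₁, hC₁⟩ := h.sobolev 1
  obtain ⟨C₂, hC₂⟩ := h.sobolev_dt 1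
  obtain ⟨-, heFc, -⟩ := hsm.enstrophy_balance hT hC₁ hC₂
  have hgc : ContinuousOn g (Icc 0 T) := continuousOn_const.mul heFc
  have heF0 : ∀ t, 0 ≤ eF t := fun t => integral_nonneg fun x => frobeniusNormSq_nonneg _
  -- continuity of the dissipation
  have hne := norm_euclideanSpace_single_one_le
  obtain ⟨hD0c, hD0i⟩ := h.continuousOn_dissipation_angVortQuot hT hax (hne 0)
  obtain ⟨hD1c, hD1i⟩ := h.continuousOn_dissipation_angVortQuot hT hax (hne 1)
  obtain ⟨hD2c, hD2i⟩ := h.continuousOn_dissipation_angVortQuot hT hax (hne 2)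
  have hDΩc : ContinuousOn DΩ (Icc 0 T) := by
    have hsum := (hD0c.add hD1c).add hD2c
    refine hsum.congr fun s hs => ?_
    have i01 : Integrable (fun x => fderiv ℝ (angVortQuot (v s)) x (EuclideanSpace.single 0 1) ^ 2 +
        fderiv ℝ (angVortQuot (v s)) x (EuclideanSpace.single 1 1) ^ 2) volume := (hD0i s hs).add (hD1i s hs)
    simp only [Pi.add_apply]
    rw [hDΩt, integral_add i01 (hD2i s hs), integral_add (hD0i s hs) (hD1i s hs)]
  have hA0 : ∀ t ∈ Icc 0 T, 0 ≤ A t := fun t _ => by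
    rw [hAt]
    exact add_nonneg (integral_nonneg fun x => sq_nonneg _)
      (mul_nonneg (by positivity) (integral_nonneg fun x => sq_nonneg _))
  -- uniform pointwise bounds of `v`, `Dv`
  obtain ⟨B, -, hB⟩ := h.exists_bound_velocity
  obtain ⟨B', -, hB'⟩ := h.sobolev.exists_forall_norm_iteratedFDeriv_le hvs 1
  have hDb : ∀ t ∈ Icc 0 T, ∀ x, ‖fderiv ℝ (v t) x‖ ≤ B' := fun t ht x => by
    rw [← norm_iteratedFDeriv_one (𝕜 := ℝ) (f := v t)]; exact hB' t ht x
  have hH : ∀ t ∈ Icc 0 T, ∀ n : ℕ, ∫⁻ x, ‖iteratedFDeriv ℝ n (v t) x‖ₑ ^ 2 < ⊤ := fun t ht n => by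
    obtain ⟨C, hC⟩ := h.sobolev n
    exact (hC t ht).trans_lt ENNReal.coe_lt_top
  ----------------------------------------------------------------
  -- the pointwise-in-time inequality `φ(τ) + (1 − θ)p² DΩ(τ) ≤ g(τ) Mx`
  ----------------------------------------------------------------
  have hpt : ∀ τ ∈ Icc 0 T, φ τ + (1 - θ) * p ^ 2 * DΩ τ ≤ g τ * Mx := by
    intro τ hτ
    have hsl := Wei2016.slice_ode_bound h.classical hU hcl hax hτ (hH τ hτ) (hB τ hτ) (hDb τ hτ) hε hε1 hp
      hp3 hθ0 hK hr₀ hΓb0 hM (hΓε τ hτ) (hΓb τ hτ)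
    obtain ⟨IJ, hIJ⟩ : ∃ IJ : ℝ, IJ = ∫ x, radVelQuot (curl (v τ)) x *
        radVelQuot (curl (timeDerivWithin (Icc 0 T) v τ)) x := ⟨_, rfl⟩
    obtain ⟨IΩ, hIΩ⟩ : ∃ IΩ : ℝ, IΩ = ∫ x, angVortQuot (v τ) x * angVortQuot (timeDerivWithin (Icc 0 T) v τ) x :=
      ⟨_, rfl⟩
    obtain ⟨DJ, hDJ⟩ : ∃ DJ : ℝ, DJ = ∫ x, (fderiv ℝ (radVelQuot (curl (v τ))) x (EuclideanSpace.single 0 1) ^ 2 +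
        fderiv ℝ (radVelQuot (curl (v τ))) x (EuclideanSpace.single 1 1) ^ 2 +
        fderiv ℝ (radVelQuot (curl (v τ))) x (EuclideanSpace.single 2 1) ^ 2) := ⟨_, rfl⟩
    obtain ⟨eo, heo⟩ : ∃ eo : ℝ, eo = ∫ x, ‖fderiv ℝ (v τ) x‖ ^ 2 := ⟨_, rfl⟩
    have hAτ : (∫ x, radVelQuot (curl (v τ)) x ^ 2) + p ^ 2 / 2 * ∫ x, angVortQuot (v τ) x ^ 2 = A τ := (hAt τ).symm
    rw [← hIJ, ← hIΩ, ← hDJ, ← hDΩt, ← heo, ← hCg, hAτ] at hsl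
    have hslA : 2 * (IJ + p ^ 2 / 2 * IΩ) + (1 - θ) * (DJ + p ^ 2 * DΩ τ) ≤
        Cg * M₂ * eo * max (A τ ^ (4 / 3 : ℝ) / κ) ρ := hsl
    -- `φ τ = 2 (IJ + p²/2 IΩ)`
    have hφτ : φ τ = 2 * (IJ + p ^ 2 / 2 * IΩ) := by
      have e1 : (∫ x, 2 * radVelQuot (curl (v τ)) x * radVelQuot (curl (timeDerivWithin (Icc 0 T) v τ)) x) =
          2 * IJ := by
        rw [hIJ, ← MeasureTheory.integral_const_mul]
        exact integral_congr_ae (Eventually.of_forall fun x => by ring)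
      have e2 : (∫ x, 2 * angVortQuot (v τ) x * angVortQuot (timeDerivWithin (Icc 0 T) v τ) x) = 2 * IΩ := by
        rw [hIΩ, ← MeasureTheory.integral_const_mul]
        exact integral_congr_ae (Eventually.of_forall fun x => by ring)
      rw [hφ]
      show (∫ x, 2 * radVelQuot (curl (v τ)) x * radVelQuot (curl (timeDerivWithin (Icc 0 T) v τ)) x) +
        p ^ 2 / 2 * ∫ x, 2 * angVortQuot (v τ) x * angVortQuot (timeDerivWithin (Icc 0 T) v τ) x =
        2 * (IJ + p ^ 2 / 2 * IΩ)
      rw [e1, e2]; ring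
    have hDJ0 : 0 ≤ DJ := by rw [hDJ]; exact integral_nonneg fun x => by positivity
    -- `∫ ‖Dv‖² ≤ ∫ |Dv|²_F`
    have h1τ : ContDiff ℝ 1 (v τ) := (hvs τ hτ).of_le (by norm_cast)
    have hfroi : Integrable (fun x => frobeniusNormSq (fderiv ℝ (v τ) x)) volume := by
      have hc : Continuous fun x => frobeniusNormSq (fderiv ℝ (v τ) x) :=
        continuous_frobeniusNormSq_fderiv h1τ one_ne_zero
      refine ⟨hc.aestronglyMeasurable, ?_⟩
      rw [HasFiniteIntegral]
      calc ∫⁻ x, ‖frobeniusNormSq (fderiv ℝ (v τ) x)‖ₑ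
          = ∫⁻ x, ENNReal.ofReal (frobeniusNormSq (fderiv ℝ (v τ) x)) :=
            lintegral_congr fun x => by rw [Real.enorm_eq_ofReal (frobeniusNormSq_nonneg _)]
        _ ≤ ∫⁻ x, 3 * ‖iteratedFDeriv ℝ 1 (v τ) x‖ₑ ^ 2 := lintegral_mono fun x => by
            rw [← ofReal_norm, norm_iteratedFDeriv_one, ofReal_norm]
            exact ofReal_frobeniusNormSq_le_three_mul_enorm_sq _
        _ = 3 * ∫⁻ x, ‖iteratedFDeriv ℝ 1 (v τ) x‖ₑ ^ 2 := lintegral_const_mul' _ _ (by simp)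
        _ < ⊤ := ENNReal.mul_lt_top (by simp) ((hC₁ τ hτ).trans_lt ENNReal.coe_lt_top)
    have heo_le : eo ≤ eF τ := by
      rw [heo]
      exact integral_mono_of_nonneg (Eventually.of_forall fun x => sq_nonneg _) hfroi
        (Eventually.of_forall fun x => sq_opNorm_le_frobeniusNormSq _)
    have heo0 : 0 ≤ eo := by rw [heo]; exact integral_nonneg fun x => sq_nonneg _
    -- `max{A^{4/3}/κ, ρ} ≤ Mx`
    have hmaxle : max (A τ ^ (4 / 3 : ℝ) / κ) ρ ≤ Mx := by
      refine max_le_max ?_ le_rfl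
      exact div_le_div_of_nonneg_right (Real.rpow_le_rpow (hA0 τ hτ) ((hAt τ).trans_le (hY τ hτ)) (by norm_num)) hκ0.le
    have hmax0 : 0 ≤ max (A τ ^ (4 / 3 : ℝ) / κ) ρ := le_max_of_le_right hρ0.le
    have hstep : Cg * M₂ * eo * max (A τ ^ (4 / 3 : ℝ) / κ) ρ ≤ g τ * Mx := by
      calc Cg * M₂ * eo * max (A τ ^ (4 / 3 : ℝ) / κ) ρ ≤ Cg * M₂ * eF τ * max (A τ ^ (4 / 3 : ℝ) / κ) ρ :=
            mul_le_mul_of_nonneg_right (mul_le_mul_of_nonneg_left heo_le (mul_nonneg hCg0 hM₂0)) hmax0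
        _ ≤ Cg * M₂ * eF τ * Mx := mul_le_mul_of_nonneg_left hmaxle (mul_nonneg (mul_nonneg hCg0 hM₂0) (heF0 τ))
        _ = g τ * Mx := by rw [hg]
    have h1θ : 0 ≤ 1 - θ := by linarith
    have hdissJ : 0 ≤ (1 - θ) * DJ := mul_nonneg h1θ hDJ0
    rw [hφτ]
    nlinarith [hslA, hstep, hdissJ]
  ----------------------------------------------------------------
  -- integrate over `(0, t)`
  ----------------------------------------------------------------
  intro t ht
  rw [show (∫ s in (0 : ℝ)..t, ∫ x, (fderiv ℝ (angVortQuot (v s)) x (EuclideanSpace.single 0 1) ^ 2 +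
      fderiv ℝ (angVortQuot (v s)) x (EuclideanSpace.single 1 1) ^ 2 +
      fderiv ℝ (angVortQuot (v s)) x (EuclideanSpace.single 2 1) ^ 2)) = ∫ s in (0 : ℝ)..t, DΩ s from
    intervalIntegral.integral_congr fun s _ => (hDΩt s).symm, ← hAt 0]
  rcases eq_or_lt_of_le ht.1 with h0 | hpos
  · subst h0
    simp only [intervalIntegral.integral_same, mul_zero]
    exact add_nonneg (hA0 0 ht) (mul_nonneg (mul_nonneg (mul_nonneg hCg0 hM₂0) (kineticEnergy_nonneg u₀)) hMx0)
  have hφI : IntervalIntegrable φ volume 0 t := by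
    rw [intervalIntegrable_iff_integrableOn_Ioo_of_le ht.1]
    exact hφi'.mono_set (Ioo_subset_Ioo_right ht.2)
  have hci : ∀ {f : ℝ → ℝ}, ContinuousOn f (Icc 0 T) → IntervalIntegrable f volume 0 t :=
    fun hf => (hf.mono (Icc_subset_Icc_right ht.2)).intervalIntegrable_of_Icc ht.1
  have hDI : IntervalIntegrable DΩ volume 0 t := hci hDΩc
  have hgI : IntervalIntegrable g volume 0 t := hci hgc
  -- `∫ (φ + (1−θ)p² DΩ) ≤ ∫ g Mx`
  have hmono : ∫ s in (0 : ℝ)..t, (φ s + (1 - θ) * p ^ 2 * DΩ s) ≤ ∫ s in (0 : ℝ)..t, g s * Mx :=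
    intervalIntegral.integral_mono_on ht.1 (hφI.add (hDI.const_mul _)) (hgI.mul_const _)
      fun s hs => hpt s ⟨hs.1, hs.2.trans ht.2⟩
  rw [intervalIntegral.integral_add hφI (hDI.const_mul _), intervalIntegral.integral_const_mul,
    intervalIntegral.integral_mul_const] at hmono
  have hbal0 := hbal' 0 t le_rfl ht.1 ht.2
  have hGb : ∫ s in (0 : ℝ)..t, g s ≤ Cg * M₂ * VectorCalculus.kineticEnergy u₀ := by
    have h1 := h.intervalIntegral_enstrophy_le hT ht
    rw [show (fun s => g s) = fun s => Cg * M₂ * eF s from rfl, intervalIntegral.integral_const_mul]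
    exact mul_le_mul_of_nonneg_left h1 (mul_nonneg hCg0 hM₂0)
  have hAt0 := hA0 t ht
  nlinarith [hmono, hGb, hMx0, hbal0]

/-- `x^{1/4} ≤ 3/4 + x/4` for `x ≥ 0` (Young). [folklore] -/
theorem Wei2016.rpow_quarter_le (x : ℝ) (hx : 0 ≤ x) : x ^ (1 / 4 : ℝ) ≤ 3 / 4 + x / 4 := by
  set y : ℝ := x ^ (1 / 4 : ℝ) with hy
  have hy0 : 0 ≤ y := Real.rpow_nonneg hx _
  have hy4 : y ^ 4 = x := by
    rw [hy, ← Real.rpow_natCast, ← Real.rpow_mul hx]; norm_num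
  rw [← hy4]
  nlinarith [sq_nonneg (y - 1), sq_nonneg (y + 1), mul_nonneg hy0 (sq_nonneg (y - 1))]

set_option maxHeartbeats 800000 in
/-- **A continuous majorant of `‖vʳ(t)/r‖_∞` with integrable bound** (Lei–Zhang 2017, §3 p. 9 /
§4 p. 10: `‖vʳ/r‖_∞ ≤ C_A‖Ω‖^{1/2}_{L²}‖∂_zΩ‖^{1/2}_{L²}`): in Tao's class with axisymmetric
slices, if `∫Ω(t)² ≤ M_Ω` on `[0, T]` and `∫₀ᵗ∫(∂_zΩ)² ≤ D`, then
`a(t) = C_A (M_Ω ∫(∂_zΩ(t))²)^{1/4}` is continuous and nonnegative on `[0, T]`,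
`|vʳ(t, x)/r| ≤ a(t)`, and `∫₀ᵗ a ≤ C_A M_Ω^{1/4} (3T/4 + D/4)`. [cite: LeiZhang2017, §3 p. 9] -/
theorem IsTaoSolutionOn.exists_radVelQuot_bound (h : IsTaoSolutionOn T 1 u₀ v q) (hT : 0 < T)
    (hax : ∀ t ∈ Icc 0 T, IsAxisymmetric (v t)) {MΩ D : ℝ} (hMΩ : 0 ≤ MΩ)
    (hΩ : ∀ t ∈ Icc 0 T, ∫ x, angVortQuot (v t) x ^ 2 ≤ MΩ)
    (hD : ∀ t ∈ Icc 0 T, ∫ s in (0 : ℝ)..t, ∫ x, fderiv ℝ (angVortQuot (v s)) x (EuclideanSpace.single 2 1) ^ 2 ≤ D) :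
    ∃ a : ℝ → ℝ, ContinuousOn a (Icc 0 T) ∧ (∀ t ∈ Icc 0 T, 0 ≤ a t) ∧
      (∀ t ∈ Icc 0 T, ∀ x, |radVelQuot (v t) x| ≤ a t) ∧
      ∀ t ∈ Icc 0 T, ∫ s in (0 : ℝ)..t, a s ≤
        (Real.sqrt newtonNearSqInt + newtonFarLaplacianL65 *
          SNormLESNormFDerivOfEqConst ℝ (volume : Measure (EuclideanSpace ℝ (Fin 3))) 2) *
        MΩ ^ (1 / 4 : ℝ) * (3 * T / 4 + D / 4) := by
  set CA : ℝ := Real.sqrt newtonNearSqInt + newtonFarLaplacianL65 *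
      SNormLESNormFDerivOfEqConst ℝ (volume : Measure (EuclideanSpace ℝ (Fin 3))) 2 with hCA
  have hCA0 : 0 ≤ CA := add_nonneg (Real.sqrt_nonneg _) (mul_nonneg newtonFarLaplacianL65_nonneg (NNReal.coe_nonneg _))
  obtain ⟨DΩz, hDΩz⟩ : ∃ DΩz : ℝ → ℝ, DΩz = fun t => ∫ x, fderiv ℝ (angVortQuot (v t)) x (EuclideanSpace.single 2 1) ^ 2 :=
    ⟨_, rfl⟩
  have hDzt : ∀ t, DΩz t = ∫ x, fderiv ℝ (angVortQuot (v t)) x (EuclideanSpace.single 2 1) ^ 2 := fun t => by rw [hDΩz]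
  have hne := norm_euclideanSpace_single_one_le
  obtain ⟨hDc, -⟩ := h.continuousOn_dissipation_angVortQuot hT hax (hne 2)
  rw [← hDΩz] at hDc
  have hDz0 : ∀ t, 0 ≤ DΩz t := fun t => by rw [hDzt]; exact integral_nonneg fun x => sq_nonneg _
  refine ⟨fun t => CA * (MΩ * DΩz t) ^ (1 / 4 : ℝ), ?_, ?_, ?_, ?_⟩
  · exact continuousOn_const.mul ((continuousOn_const.mul hDc).rpow_const fun t _ => Or.inr (by norm_num))
  · intro t _; exact mul_nonneg hCA0 (Real.rpow_nonneg (mul_nonneg hMΩ (hDz0 t)) _)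
  · intro t ht x
    have hvs : ContDiff ℝ ∞ (v t) := h.classical.contDiff_velocity ht
    have hH : ∀ n : ℕ, ∫⁻ x, ‖iteratedFDeriv ℝ n (v t) x‖ₑ ^ 2 < ⊤ := fun n => by
      obtain ⟨C, hC⟩ := h.sobolev n; exact (hC t ht).trans_lt ENNReal.coe_lt_top
    have h1 := (hax t ht).abs_radVelQuot_le_of_sobolev hvs (h.classical.divFree t ht) hH x
    rw [← hDzt] at h1
    refine h1.trans (mul_le_mul_of_nonneg_left (Real.rpow_le_rpow ?_ ?_ (by norm_num)) hCA0)
    · exact mul_nonneg (integral_nonneg fun y => sq_nonneg _) (hDz0 t)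
    · exact mul_le_mul_of_nonneg_right (hΩ t ht) (hDz0 t)
  · intro t ht
    have hci : IntervalIntegrable DΩz volume 0 t := (hDc.mono (Icc_subset_Icc_right ht.2)).intervalIntegrable_of_Icc ht.1
    have hpt : ∀ s ∈ Icc 0 t, CA * (MΩ * DΩz s) ^ (1 / 4 : ℝ) ≤ CA * MΩ ^ (1 / 4 : ℝ) * (3 / 4 + DΩz s / 4) := by
      intro s _
      rw [Real.mul_rpow hMΩ (hDz0 s), mul_assoc]
      exact mul_le_mul_of_nonneg_left (mul_le_mul_of_nonneg_left (Wei2016.rpow_quarter_le _ (hDz0 s))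
        (Real.rpow_nonneg hMΩ _)) hCA0
    have hmono : ∫ s in (0 : ℝ)..t, CA * (MΩ * DΩz s) ^ (1 / 4 : ℝ) ≤
        ∫ s in (0 : ℝ)..t, CA * MΩ ^ (1 / 4 : ℝ) * (3 / 4 + DΩz s / 4) := by
      refine intervalIntegral.integral_mono_on ht.1 ?_ ?_ hpt
      · exact ((continuousOn_const.mul ((continuousOn_const.mul hDc).rpow_const fun t _ => Or.inr (by norm_num))).mono
          (Icc_subset_Icc_right ht.2)).intervalIntegrable_of_Icc ht.1
      · exact (intervalIntegrable_const.add (hci.div_const 4)).const_mul _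
    have heval : ∫ s in (0 : ℝ)..t, CA * MΩ ^ (1 / 4 : ℝ) * (3 / 4 + DΩz s / 4) =
        CA * MΩ ^ (1 / 4 : ℝ) * (3 * t / 4 + (∫ s in (0 : ℝ)..t, DΩz s) / 4) := by
      rw [intervalIntegral.integral_const_mul, intervalIntegral.integral_add intervalIntegrable_const (hci.div_const 4),
        intervalIntegral.integral_const, intervalIntegral.integral_div]
      simp only [sub_zero, smul_eq_mul]
      ring
    rw [heval] at hmono
    refine hmono.trans (mul_le_mul_of_nonneg_left ?_ (mul_nonneg hCA0 (Real.rpow_nonneg hMΩ _)))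
    have hDt : ∫ s in (0 : ℝ)..t, DΩz s ≤ D := by
      have := hD t ht
      rwa [show (fun s => ∫ x, fderiv ℝ (angVortQuot (v s)) x (EuclideanSpace.single 2 1) ^ 2) = DΩz from hDΩz.symm] at this
    nlinarith [ht.2, hDt]

end Literature.Analysis.FluidPDE

end
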